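import Mathlib
import Literature.RepresentationTheory.FiniteGroups.IrreducibleCharacters
import Summits.MatrixMultiplication.MatrixMultiplication.Theorems.LevelGradedCohnUmansGradedDesignFamilyStubPowerSep
import Summits.MatrixMultiplication.MatrixMultiplication.Theorems.LevelGradedCohnUmansGradedDesignFamilyStubProdBudget
import Summits.MatrixMultiplication.MatrixMultiplication.Theorems.LevelGradedCohnUmansGradedDesignFamilyStubPowerBudget
import Summits.MatrixMultiplication.MatrixMultiplication.Theorems.LevelGradedCohnUmansGradedDesignFamilyStubWreathSep
import Summits.MatrixMultiplication.MatrixMultiplication.Theorems.LevelGradedCohnUmansGradedDesignFamilyStubWreathBudget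
import Summits.MatrixMultiplication.MatrixMultiplication.Theorems.LevelGradedCohnUmansGradedDesignFamilyStubAmplify

/-!
# The graded CKSU wreath lift at one exponent — explicit-host form (siege k18 of `gradedWreathLinkAt`)

Route `LevelGradedCohnUmans`, crux `GradedDesignFamily` (stmt-MatrixMultiplication-7610), registered stub
`gradedWreathLinkAt`: at a fixed exponent `2 + ε` (`ε ≥ 0`), a finite group `G`, a bi-invariant test space
`J ≤ ℂ^G` and a SIMULTANEOUSLY `J`-separated family of `t` pieces `(X_i, Y_i, Z_i)` whose total
`Σ_i (|X_i||Y_i||Z_i|)^{(2+ε)/3}` beats the graded budget `Σ_{χ ∈ Irr G ∩ J} χ(1)^{2+ε}` give ONE finite group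
with ONE separated triple beating its own graded budget at the same exponent
[cite: CohnKleinbergSzegedyUmans2005, Thm. 7.1 with the type-class restriction of p. 12].

This file is the EXPLICIT / ELEMENTARY assembly of the lift: the analysis (choice of the power `N` and of a
set `T` of `M` words, `stub_amplify`) is separated from the algebra, and the algebra is stated as ONE explicit,
amplification-free theorem about a NAMED host,

* `wreathHost_design` — for EVERY power `N` and EVERY finite set `T` of words `Fin N → ι`, the permutation
  wreath host `W(T) := (↥T → (Fin N → G)) ⋊ Perm ↥T` carries a bi-invariant test space `J_W` and a
  `J_W`-separated triple `(X̂, Ŷ, Ẑ)` with the closed-form sizes `|X̂| = M! · Π_{w ∈ T} Π_k |X_{w k}|` (same for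
  `Ŷ`, `Ẑ`; `M = |T|`) and the closed-form graded budget bound
  `Σ_{χ ∈ Irr W ∩ J_W} χ(1)^s ≤ (M!)^{s-1} · (B_s(G, J)^N)^M` for every `s ≥ 2`
  (`stub_powerSep` + `stub_wreathSep` for the pattern, `stub_wreathBudget ∘ stub_powerBudget ∘ stub_prodBudget`
  for the budget; all six are landed helper files of the crux and are only composed here);
* `gradedWreathLinkAt` — the registered stub, verbatim: `wreathHost_design` at the pair `(N, T)` supplied by
  `stub_amplify`, followed by the one-line volume identity
  `(M!)^3 Π_{w∈T} Π_k |X_{wk}||Y_{wk}||Z_{wk}| = |X̂||Ŷ||Ẑ|`;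
* `gradedWreathLink_fintype` — the same for families indexed by an arbitrary finite type `ι` (reindex along
  `Fintype.equivFin ι`), the entry point for constructors whose pieces are indexed by cosets / words / designs.

Design choice: the host, its test space and the three sets are the concrete objects of CKSU's proof (no choice
beyond `(N, T)`), so the quantitative content of the lift — how large the lifted design and its budget are — is
available by name to the census / disproof seats of the crux, which price lifted designs.  Nothing here restates
the crux or any other registered stub; Mathlib + the tree's `irrChars` vocabulary + the six landed stub files only.
The declarations live in the sub-namespace `…Theorems.GradedDesignFamily.ExplicitHost` (the line lead's
composition `…Theorems.GradedDesignFamily.gradedWreathLinkAt`, file `…GradedDesignFamilyWreathLink`, owns the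
parent name; the two files are independent and can be imported together).
-/

noncomputable section

-- `Summit.<Summit>.<Problem>` is the tree's mandated summit-side namespace; for this single-conjunct summit the
-- two components coincide, so the file silences `dupNamespace` (as every file of this crux does).
set_option linter.dupNamespace false
set_option autoImplicit false

open scoped BigOperators
open Literature.RepresentationTheory.FiniteGroups

namespace Summit.MatrixMultiplication.MatrixMultiplication.Theorems.GradedDesignFamily.ExplicitHost

/-- Pulling a simultaneously `S`-separated family back along an injection `e : ι' → ι` of index types keeps
it simultaneously `S`-separated, with the same separators. [folklore] -/
private theorem simSep_comap {G : Type} [Group G] {ι ι' : Type} (S : Set (G → ℂ))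
    (X Y Z : ι → Finset G) (e : ι' → ι) (he : Function.Injective e)
    (hsep : ∀ i : ι, ∀ x₀ ∈ X i, ∀ z₀ ∈ Z i, ∃ f ∈ S, ∀ a b : ι, ∀ x ∈ X a, ∀ y ∈ Y a, ∀ y' ∈ Y b,
      ∀ z ∈ Z b, ((a = i ∧ b = i ∧ x = x₀ ∧ y = y' ∧ z = z₀) → f (x⁻¹ * y * y'⁻¹ * z) = 1) ∧
        (¬ (a = i ∧ b = i ∧ x = x₀ ∧ y = y' ∧ z = z₀) → f (x⁻¹ * y * y'⁻¹ * z) = 0)) :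
    ∀ i : ι', ∀ x₀ ∈ X (e i), ∀ z₀ ∈ Z (e i), ∃ f ∈ S, ∀ a b : ι', ∀ x ∈ X (e a), ∀ y ∈ Y (e a),
      ∀ y' ∈ Y (e b), ∀ z ∈ Z (e b),
        ((a = i ∧ b = i ∧ x = x₀ ∧ y = y' ∧ z = z₀) → f (x⁻¹ * y * y'⁻¹ * z) = 1) ∧
        (¬ (a = i ∧ b = i ∧ x = x₀ ∧ y = y' ∧ z = z₀) → f (x⁻¹ * y * y'⁻¹ * z) = 0) := by
  intro i x₀ hx₀ z₀ hz₀
  obtain ⟨f, hf, hfs⟩ := hsep (e i) x₀ hx₀ z₀ hz₀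
  refine ⟨f, hf, fun a b x hx y hy y' hy' z hz => ?_⟩
  obtain ⟨h1, h0⟩ := hfs (e a) (e b) x hx y hy y' hy' z hz
  refine ⟨fun h => h1 ⟨congrArg e h.1, congrArg e h.2.1, h.2.2⟩, fun h => h0 fun h' => h ?_⟩
  exact ⟨he h'.1, he h'.2.1, h'.2.2⟩

/-- **The lifted design in the explicit wreath host.**  Let `J ≤ ℂ^G` be bi-invariant and
`(X_i, Y_i, Z_i)_{i : ι}` simultaneously `J`-separated.  For every power `N` and every finite set `T` of words
`Fin N → ι` (`M := |T|`), the permutation wreath host `W := (↥T → (Fin N → G)) ⋊ Perm ↥T` carries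
* the test space `J_W = span{w ↦ [w.right = τ₀] · Π_{u ∈ T} g_u (w.left u) : τ₀ ∈ Perm ↥T, g_u ∈ J^{⊠N}}`,
  `J^{⊠N} = span{h ↦ Π_k f_k (h k) : f_k ∈ J}`, which is bi-invariant;
* the triple `X̂ = (Π_{u ∈ T} Π_k X_{u k}) × Perm ↥T`, `Ŷ`, `Ẑ` (likewise), which is `J_W`-separated;
* the sizes `|X̂| = M! · Π_{w ∈ T} Π_k |X_{w k}|` (same for `Ŷ`, `Ẑ`);
* the graded budget bound `Σ_{χ ∈ Irr W ∩ J_W} χ(1)^s ≤ (M!)^{s-1} · ((Σ_{χ ∈ Irr G ∩ J} χ(1)^s)^N)^M`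
  for every real `s ≥ 2`.
This is the algebraic half of [cite: CohnKleinbergSzegedyUmans2005, Thm. 7.1] in graded form, with NO
amplification: it holds for every `(N, T)`. -/
theorem wreathHost_design {G : Type} [Group G] [Fintype G] [DecidableEq G] {ι : Type} [Fintype ι]
    [DecidableEq ι] (J : Submodule ℂ (G → ℂ))
    (hJ : ∀ f ∈ J, ∀ a b : G, (fun g : G => f (a * g * b)) ∈ J) (X Y Z : ι → Finset G)
    (hsep : ∀ i : ι, ∀ x₀ ∈ X i, ∀ z₀ ∈ Z i, ∃ f ∈ J, ∀ a b : ι, ∀ x ∈ X a, ∀ y ∈ Y a,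
      ∀ y' ∈ Y b, ∀ z ∈ Z b,
        ((a = i ∧ b = i ∧ x = x₀ ∧ y = y' ∧ z = z₀) → f (x⁻¹ * y * y'⁻¹ * z) = 1) ∧
        (¬ (a = i ∧ b = i ∧ x = x₀ ∧ y = y' ∧ z = z₀) → f (x⁻¹ * y * y'⁻¹ * z) = 0))
    {N : ℕ} (T : Finset (Fin N → ι)) (s : ℝ) (hs : 2 ≤ s) :
    ∃ (JW : Submodule ℂ (((↥T → (Fin N → G)) ⋊[mulAutArrow] Equiv.Perm ↥T) → ℂ))
      (XW YW ZW : Finset ((↥T → (Fin N → G)) ⋊[mulAutArrow] Equiv.Perm ↥T)),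
      (∀ F ∈ JW, ∀ a b : (↥T → (Fin N → G)) ⋊[mulAutArrow] Equiv.Perm ↥T,
        (fun w : (↥T → (Fin N → G)) ⋊[mulAutArrow] Equiv.Perm ↥T => F (a * w * b)) ∈ JW) ∧
      (∀ x₀ ∈ XW, ∀ z₀ ∈ ZW, ∃ F ∈ JW, ∀ x ∈ XW, ∀ y ∈ YW, ∀ y' ∈ YW, ∀ z ∈ ZW,
        (x = x₀ ∧ y = y' ∧ z = z₀ → F (x⁻¹ * y * y'⁻¹ * z) = 1) ∧
        (¬ (x = x₀ ∧ y = y' ∧ z = z₀) → F (x⁻¹ * y * y'⁻¹ * z) = 0)) ∧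
      XW.card = T.card.factorial * ∏ w ∈ T, ∏ k, (X (w k)).card ∧
      YW.card = T.card.factorial * ∏ w ∈ T, ∏ k, (Y (w k)).card ∧
      ZW.card = T.card.factorial * ∏ w ∈ T, ∏ k, (Z (w k)).card ∧
      (∑ᶠ χ ∈ irrChars ((↥T → (Fin N → G)) ⋊[mulAutArrow] Equiv.Perm ↥T) ∩
          (JW : Set (((↥T → (Fin N → G)) ⋊[mulAutArrow] Equiv.Perm ↥T) → ℂ)), (χ 1).re ^ s) ≤
        ((T.card.factorial : ℕ) : ℝ) ^ (s - 1) *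
          ((∑ᶠ χ ∈ irrChars G ∩ (J : Set (G → ℂ)), (χ 1).re ^ s) ^ N) ^ T.card := by
  -- the power test space `J^{⊠N}` on `Fin N → G`
  set K : Submodule ℂ ((Fin N → G) → ℂ) := Submodule.span ℂ {F : (Fin N → G) → ℂ |
    ∃ g : Fin N → (G → ℂ), (∀ k, g k ∈ J) ∧ F = fun h => ∏ k, g k (h k)} with hK_def
  -- Step 1 (direct power): the word family in `G^N` is simultaneously `K`-separated, `K` bi-invariant
  obtain ⟨hK, hsepN⟩ := stub_powerSep (ι := ι) (κ := Fin N) J hJ X Y Z hsep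
  -- Step 2 (restriction): keep only the words of `T`
  have hsepT := simSep_comap (K : Set ((Fin N → G) → ℂ))
    (fun w : Fin N → ι => Fintype.piFinset fun k => X (w k))
    (fun w => Fintype.piFinset fun k => Y (w k)) (fun w => Fintype.piFinset fun k => Z (w k))
    (fun w : ↥T => (w : Fin N → ι)) Subtype.coe_injective hsepN
  -- Step 3 (wreath step over the index type `↥T`): bi-invariance and separation in the host
  obtain ⟨hJW, hsepW⟩ := stub_wreathSep (ι := ↥T) K hK
    (fun w : ↥T => Fintype.piFinset fun k => X ((w : Fin N → ι) k))
    (fun w => Fintype.piFinset fun k => Y ((w : Fin N → ι) k))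
    (fun w => Fintype.piFinset fun k => Z ((w : Fin N → ι) k)) hsepT
  refine ⟨_, _, _, _, hJW, hsepW, ?_, ?_, ?_, ?_⟩
  -- Step 4 (sizes): `|(Π_u A_u) × Perm ↥T| = M! · Π_{w ∈ T} |A_w|`, `|A_w| = Π_k |X_{w k}|`
  · rw [Finset.card_map, Finset.card_product, Fintype.card_piFinset, Finset.card_univ,
      Fintype.card_perm, Fintype.card_coe, mul_comm]
    simp only [Fintype.card_piFinset]
    rw [← Finset.prod_coe_sort T]
  · rw [Finset.card_map, Finset.card_product, Fintype.card_piFinset, Finset.card_univ,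
      Fintype.card_perm, Fintype.card_coe, mul_comm]
    simp only [Fintype.card_piFinset]
    rw [← Finset.prod_coe_sort T]
  · rw [Finset.card_map, Finset.card_product, Fintype.card_piFinset, Finset.card_univ,
      Fintype.card_perm, Fintype.card_coe, mul_comm]
    simp only [Fintype.card_piFinset]
    rw [← Finset.prod_coe_sort T]
  -- Step 5 (budget): wreath index bound, then the two direct-power bounds
  · have h5 := stub_wreathBudget (ι := ↥T) K hK s hs
    have h3T := stub_powerBudget (κ := ↥T) K s
      (fun K' L' _ _ _ _ _ _ JK JL => stub_prodBudget K' L' JK JL s)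
    have h3N := stub_powerBudget (κ := Fin N) J s
      (fun K' L' _ _ _ _ _ _ JK JL => stub_prodBudget K' L' JK JL s)
    rw [Fintype.card_fin] at h3N
    rw [Fintype.card_coe] at h5 h3T
    have hKN0 : 0 ≤ ∑ᶠ χ ∈ irrChars (Fin N → G) ∩ (K : Set ((Fin N → G) → ℂ)), (χ 1).re ^ s :=
      powerBudget_nonneg _ s
    have hfac0 : (0 : ℝ) ≤ ((T.card.factorial : ℕ) : ℝ) ^ (s - 1) :=
      Real.rpow_nonneg (Nat.cast_nonneg _) _
    exact h5.trans (mul_le_mul_of_nonneg_left (h3T.trans (pow_le_pow_left₀ hKN0 h3N _)) hfac0)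

/-- **The graded CKSU wreath lift at one exponent** (registered stub `gradedWreathLinkAt` of the crux
`GradedDesignFamily`, explicit assembly): for `ε ≥ 0`, a finite group `G`, a bi-invariant `J ≤ ℂ^G` and a
simultaneously `J`-separated family `(X_i, Y_i, Z_i)_{i < t}` with
`Σ_{χ ∈ Irr G ∩ J} χ(1)^{2+ε} < Σ_i (|X_i||Y_i||Z_i|)^{(2+ε)/3}` yield a finite group with a bi-invariant test
space and ONE separated triple beating its graded budget at exponent `2 + ε`.  Proof: `stub_amplify` picks a
power `N` and a set `T` of `M` words with `(M!)^{1+ε} (B^N)^M < ((M!)^3 Π_{w ∈ T} Π_k V_{w k})^{(2+ε)/3}`;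
`wreathHost_design` at `(N, T)` is a design in `(↥T → (Fin N → G)) ⋊ Perm ↥T` whose budget is at most the
left-hand side and whose volume `|X̂||Ŷ||Ẑ|` is the base of the right-hand side.
[cite: CohnKleinbergSzegedyUmans2005, Thm. 7.1] -/
theorem gradedWreathLinkAt (ε : ℝ) (hε : 0 ≤ ε)
    (hfam : ∃ (G : Type) (_ : Group G) (_ : Fintype G)
      (J : Submodule ℂ (G → ℂ)) (t : ℕ) (X Y Z : Fin t → Finset G),
      (∀ f ∈ J, ∀ a b : G, (fun g : G => f (a * g * b)) ∈ J) ∧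
      (∀ i : Fin t, ∀ x₀ ∈ X i, ∀ z₀ ∈ Z i, ∃ f ∈ J, ∀ a b : Fin t, ∀ x ∈ X a, ∀ y ∈ Y a,
        ∀ y' ∈ Y b, ∀ z ∈ Z b,
          ((a = i ∧ b = i ∧ x = x₀ ∧ y = y' ∧ z = z₀) → f (x⁻¹ * y * y'⁻¹ * z) = 1) ∧
          (¬ (a = i ∧ b = i ∧ x = x₀ ∧ y = y' ∧ z = z₀) → f (x⁻¹ * y * y'⁻¹ * z) = 0)) ∧
      (∑ᶠ χ ∈ irrChars G ∩ (J : Set (G → ℂ)), (χ 1).re ^ (2 + ε)) <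
        ∑ i, (((X i).card * (Y i).card * (Z i).card : ℕ) : ℝ) ^ ((2 + ε) / 3)) :
    ∃ (G : Type) (_ : Group G) (_ : Fintype G) (J : Submodule ℂ (G → ℂ)) (X Y Z : Finset G),
      (∀ f ∈ J, ∀ a b : G, (fun g : G => f (a * g * b)) ∈ J) ∧
      (∀ x₀ ∈ X, ∀ z₀ ∈ Z, ∃ f ∈ J, ∀ x ∈ X, ∀ y ∈ Y, ∀ y' ∈ Y, ∀ z ∈ Z,
        (x = x₀ ∧ y = y' ∧ z = z₀ → f (x⁻¹ * y * y'⁻¹ * z) = 1) ∧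
        (¬ (x = x₀ ∧ y = y' ∧ z = z₀) → f (x⁻¹ * y * y'⁻¹ * z) = 0)) ∧
      (∑ᶠ χ ∈ Literature.RepresentationTheory.FiniteGroups.irrChars G ∩ (J : Set (G → ℂ)),
        (χ 1).re ^ (2 + ε)) < ((X.card * Y.card * Z.card : ℕ) : ℝ) ^ ((2 + ε) / 3) := by
  classical
  obtain ⟨G, instG, instF, J, t, X, Y, Z, hJ, hsep, hlt⟩ := hfam
  -- the exponent, the base budget and the volumes of the pieces
  set s : ℝ := 2 + ε with hs_def
  have hs2 : (2 : ℝ) ≤ s := by rw [hs_def]; linarith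
  have hB0 : 0 ≤ ∑ᶠ χ ∈ irrChars G ∩ (J : Set (G → ℂ)), (χ 1).re ^ s :=
    powerBudget_nonneg (J : Set (G → ℂ)) s
  set v : Fin t → ℝ := fun i => (((X i).card * (Y i).card * (Z i).card : ℕ) : ℝ) with hv_def
  have hv : ∀ i, 0 ≤ v i := fun i => by rw [hv_def]; exact Nat.cast_nonneg _
  have hlt' : (∑ᶠ χ ∈ irrChars G ∩ (J : Set (G → ℂ)), (χ 1).re ^ s) < ∑ i, v i ^ (s / 3) := by
    rw [hv_def, hs_def]; exact hlt
  -- the analysis: a power `N` and a set `T` of words (`stub_amplify`)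
  obtain ⟨N, T, hamp⟩ := stub_amplify t s _ hB0 v hv hlt'
  -- the algebra: the explicit design in the wreath host `(↥T → (Fin N → G)) ⋊ Perm ↥T`
  obtain ⟨JW, XW, YW, ZW, hJW, hsepW, hX, hY, hZ, hbud⟩ := wreathHost_design J hJ X Y Z hsep T s hs2
  letI : Fintype ((↥T → (Fin N → G)) ⋊[mulAutArrow] Equiv.Perm ↥T) :=
    Fintype.ofEquiv _ (SemidirectProduct.equivProd (N := ↥T → (Fin N → G))
      (G := Equiv.Perm ↥T) (φ := mulAutArrow)).symm
  refine ⟨(↥T → (Fin N → G)) ⋊[mulAutArrow] Equiv.Perm ↥T, inferInstance, inferInstance,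
    JW, XW, YW, ZW, hJW, hsepW, ?_⟩
  -- budget ≤ (M!)^{s-1} (B^N)^M < ((M!)^3 Π_{w∈T} Π_k V_{wk})^{s/3} = (|X̂||Ŷ||Ẑ|)^{s/3}
  refine hbud.trans_lt (hamp.trans_eq ?_)
  congr 1
  rw [hX, hY, hZ, hv_def]
  push_cast
  simp only [Finset.prod_mul_distrib]
  ring

/-- **The lift for families over an arbitrary finite index type** (convenience form of
`gradedWreathLinkAt` for constructors whose pieces are naturally indexed by cosets, words, designs, …):
reindex the family along `Fintype.equivFin ι` (separators unchanged, total volume unchanged) and apply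
`gradedWreathLinkAt`. [cite: CohnKleinbergSzegedyUmans2005, Thm. 7.1] -/
theorem gradedWreathLink_fintype (ε : ℝ) (hε : 0 ≤ ε)
    (hfam : ∃ (G : Type) (_ : Group G) (_ : Fintype G)
      (J : Submodule ℂ (G → ℂ)) (ι : Type) (_ : Fintype ι) (X Y Z : ι → Finset G),
      (∀ f ∈ J, ∀ a b : G, (fun g : G => f (a * g * b)) ∈ J) ∧
      (∀ i : ι, ∀ x₀ ∈ X i, ∀ z₀ ∈ Z i, ∃ f ∈ J, ∀ a b : ι, ∀ x ∈ X a, ∀ y ∈ Y a,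
        ∀ y' ∈ Y b, ∀ z ∈ Z b,
          ((a = i ∧ b = i ∧ x = x₀ ∧ y = y' ∧ z = z₀) → f (x⁻¹ * y * y'⁻¹ * z) = 1) ∧
          (¬ (a = i ∧ b = i ∧ x = x₀ ∧ y = y' ∧ z = z₀) → f (x⁻¹ * y * y'⁻¹ * z) = 0)) ∧
      (∑ᶠ χ ∈ irrChars G ∩ (J : Set (G → ℂ)), (χ 1).re ^ (2 + ε)) <
        ∑ i, (((X i).card * (Y i).card * (Z i).card : ℕ) : ℝ) ^ ((2 + ε) / 3)) :
    ∃ (G : Type) (_ : Group G) (_ : Fintype G) (J : Submodule ℂ (G → ℂ)) (X Y Z : Finset G),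
      (∀ f ∈ J, ∀ a b : G, (fun g : G => f (a * g * b)) ∈ J) ∧
      (∀ x₀ ∈ X, ∀ z₀ ∈ Z, ∃ f ∈ J, ∀ x ∈ X, ∀ y ∈ Y, ∀ y' ∈ Y, ∀ z ∈ Z,
        (x = x₀ ∧ y = y' ∧ z = z₀ → f (x⁻¹ * y * y'⁻¹ * z) = 1) ∧
        (¬ (x = x₀ ∧ y = y' ∧ z = z₀) → f (x⁻¹ * y * y'⁻¹ * z) = 0)) ∧
      (∑ᶠ χ ∈ Literature.RepresentationTheory.FiniteGroups.irrChars G ∩ (J : Set (G → ℂ)),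
        (χ 1).re ^ (2 + ε)) < ((X.card * Y.card * Z.card : ℕ) : ℝ) ^ ((2 + ε) / 3) := by
  obtain ⟨G, instG, instF, J, ι, instι, X, Y, Z, hJ, hsep, hlt⟩ := hfam
  refine gradedWreathLinkAt ε hε ⟨G, instG, instF, J, Fintype.card ι,
    fun j => X ((Fintype.equivFin ι).symm j), fun j => Y ((Fintype.equivFin ι).symm j),
    fun j => Z ((Fintype.equivFin ι).symm j), hJ, ?_, ?_⟩
  · exact simSep_comap (J : Set (G → ℂ)) X Y Z _ (Fintype.equivFin ι).symm.injective hsep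
  · exact hlt.trans_eq ((Fintype.equivFin ι).symm.sum_comp
      (fun i => (((X i).card * (Y i).card * (Z i).card : ℕ) : ℝ) ^ ((2 + ε) / 3))).symm

end Summit.MatrixMultiplication.MatrixMultiplication.Theorems.GradedDesignFamily.ExplicitHost

end
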